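import Summits.SmoothPoincare4.SmoothPoincare4.Theorems.CongruenceShadowsNormalFormStablyTrivialLuftReduction

/-!
# Line `shadow-split` for crux `NormalFormStablyTrivial` (stmt-SmoothPoincare4-14591) — SKELETON v1
# (crux-strategist, EXEMPT-46 re-exam): the Artin split of the route, STABLE form, on the Luft locus

The line `luft-twist-reduction` (lead c3/c4; `Lines/luft_twist_reduction.lean`, theorems
`…LuftDefs.lean` p128507, `…LuftReduction.lean` p132691) proved that modulo Nielsen the crux `X` is
EQUIVALENT to its residual `TwistGate` (gate triples of `{1}` with standard free shadow are stably
trivial) — so that skeleton has ONE mathematically open stub, which is `X` on a WLOG locus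
(re-exam verdict PIECE-EQUIVALENT).  This skeleton cuts `TwistGate` along the route's own thesis
(BLIND ∧ APPROXIMATION, M. Artin's "formal ⇒ actual"), in stable form:

* `stub_nielsenLift` — Nielsen 1927 (the Literature named fact; shared with the Luft line, whose
  lead is formalising it via Zieschang; classical, open only as a formalisation);
* `stub_twistShadowsStandard` — **BLIND ON THE LUFT LOCUS**: a gate triple with standard free shadow
  has standard shadows in every characteristic finite quotient of `S_{3+3m}`.  NOT a consequence of
  SPC4 (a non-standard trisection of `S⁴` on the locus with a non-standard shadow refutes it),
  implied by the route crux `ShadowsStandard` (stmt-14593), decidable by finite / profinite group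
  theory (Dunfield–Thurston mixing; Nakayama / finitary Andrews–Curtis; abelian level = 14599 landed);
* `stub_shadowTwistGate` — **STABLE APPROXIMATION ON THE LUFT LOCUS** (HARDEST; the residual): a gate
  triple with standard free shadow AND standard characteristic finite shadows is stably trivial.
  Implied by `X` (restriction); returns `X` only together with BLIND, which is research-open and
  SPC4-independent — so it is not `X` on a WLOG locus.  Stable form of `ShadowApproximation`
  (stmt-14595): the judge's key risk (MSZ Conj. 3.11) does not bite.

Composition `NormalFormStablyTrivial_of` (sorry-free; = evidence `ShadowSplit.lean`
`normalFormStablyTrivial_of_twistShadows`, rc 0): WLOG gate form (Nielsen) → Luft reduction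
(`luftReduction_of_nielsen`, landed) → BLIND on the reduced triple → residual → `Iso`-transport back
(Nielsen) → descent.  The three stubs are VERBATIM the children `NielsenLift`,
`TwistShadowsStandard`, `ShadowTwistGate` of the prepared route split (`Lines/shadow-split.md`
§Split; the `route edit --split` op is final-cycle-gated).

Disproof.lean honoured: §3/§6 — both research stubs keep the full gate datum `InGate` (π₁, β, γ);
§4 — Nielsen paid by name; §5(ii) — nothing unstable claimed; `-- Targets`: none against this line.
-/

-- the prescribed namespace `Summit.<P>.<Sub>.…` duplicates `SmoothPoincare4` (P = Sub)
set_option linter.dupNamespace false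

noncomputable section

namespace Summit.SmoothPoincare4.SmoothPoincare4.Cruxes.NormalFormStablyTrivial.ShadowSplit

open Literature.Topology.FourManifolds Subgroup
open Summit.SmoothPoincare4.SmoothPoincare4.Theses.CongruenceShadows (NormalFormStablyTrivial)
open Summit.SmoothPoincare4.SmoothPoincare4.Theorems.NormalFormStablyTrivial.Negative
  (InGate normalFormStablyTrivial_iff_gate_of_nielsen isoInvariant_of_nielsen)
open Summit.SmoothPoincare4.SmoothPoincare4.Theorems.AgkCor6Sufficiency.Negative
  (isStablyTrivial_cast_iff isStablyTrivial_of_stabilizeIter)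
open Summit.SmoothPoincare4.SmoothPoincare4.Theorems.NormalFormStablyTrivial.Luft
  (S N level_add FreeShadowStandard luftReduction_of_nielsen)

/-! ## The registered stubs (`sorry` only here) -/

/-- STUB (L, classical — Nielsen 1927 + Magnus; the Literature named fact; shared with the Luft
line): every automorphism of `S_g` lifts to the free group sending the relator to a conjugate of
`r^{±1}`. -/
theorem stub_nielsenLift : nielsen_surfaceGroup_mulEquiv_lift := by
  sorry

/-- STUB (L, research — BLIND ON THE LUFT LOCUS; SPC4-independent): a gate triple of the trivial
group with standard free shadow has standard shadows in every characteristic finite quotient. -/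
theorem stub_twistShadowsStandard :
    ∀ (m : ℕ) (K : TrisectionKernels (3 + 3 * m)), InGate m K → FreeShadowStandard m K →
      ∀ M : Subgroup (S m), M.Characteristic → M.FiniteIndex →
        ∃ ψ : S m ≃* S m, ∀ i : Fin 3, (N m i ⊔ M).map ψ.toMonoidHom = K i ⊔ M := by
  sorry

/-- STUB (HARDEST, open — STABLE APPROXIMATION ON THE LUFT LOCUS, the residual): a gate triple of
the trivial group with standard free shadow and standard characteristic finite shadows is stably
trivial. -/
theorem stub_shadowTwistGate :
    ∀ (m : ℕ) (K : TrisectionKernels (3 + 3 * m)), InGate m K → FreeShadowStandard m K →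
      (∀ M : Subgroup (S m), M.Characteristic → M.FiniteIndex →
        ∃ ψ : S m ≃* S m, ∀ i : Fin 3, (N m i ⊔ M).map ψ.toMonoidHom = K i ⊔ M) →
      K.IsStablyTrivial := by
  sorry

/-! ## The composition (no `sorry` below this line) -/

/-- **Nielsen ∧ BLIND-on-the-locus ∧ stable-APPROXIMATION-on-the-locus ⇒ the crux.** -/
theorem NormalFormStablyTrivial_of (hN : nielsen_surfaceGroup_mulEquiv_lift)
    (hB : ∀ (m : ℕ) (K : TrisectionKernels (3 + 3 * m)), InGate m K → FreeShadowStandard m K →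
      ∀ M : Subgroup (S m), M.Characteristic → M.FiniteIndex →
        ∃ ψ : S m ≃* S m, ∀ i : Fin 3, (N m i ⊔ M).map ψ.toMonoidHom = K i ⊔ M)
    (hG : ∀ (m : ℕ) (K : TrisectionKernels (3 + 3 * m)), InGate m K → FreeShadowStandard m K →
      (∀ M : Subgroup (S m), M.Characteristic → M.FiniteIndex →
        ∃ ψ : S m ≃* S m, ∀ i : Fin 3, (N m i ⊔ M).map ψ.toMonoidHom = K i ⊔ M) →
      K.IsStablyTrivial) :
    NormalFormStablyTrivial := by
  -- (1) WLOG gate form `(K₀, K₁) = (N₀, N₁)`: costs exactly Nielsen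
  rw [normalFormStablyTrivial_iff_gate_of_nielsen hN]
  intro m K hK
  -- (2) LUFT REDUCTION: after `n` stabilisations and a Goeritz re-marking the free shadow of the
  -- reduced gate triple `K'` is standard on the nose
  obtain ⟨n, K', hK', hsh, hiso⟩ := luftReduction_of_nielsen hN m K hK
  -- (3) BLIND on the locus: the characteristic finite shadows of `K'` are standard
  have hshad : ∀ M : Subgroup (S (m + n)), M.Characteristic → M.FiniteIndex →
      ∃ ψ : S (m + n) ≃* S (m + n), ∀ i : Fin 3,
        (N (m + n) i ⊔ M).map ψ.toMonoidHom = K' i ⊔ M :=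
    hB (m + n) K' hK' hsh
  -- (4) the residual on the locus: `K'` is stably trivial
  have h' : K'.IsStablyTrivial := hG (m + n) K' hK' hsh hshad
  -- (5) transport back along the re-marking (Nielsen) and descend the `n` stabilisations
  have h'' : ((K.stabilizeIter n).cast (level_add m n)).IsStablyTrivial :=
    isoInvariant_of_nielsen hN _ K' _ hiso.symm h'
  rw [isStablyTrivial_cast_iff] at h''
  exact isStablyTrivial_of_stabilizeIter K n h''

/-- The skeleton closes the crux modulo the three registered stubs. -/
theorem normalFormStablyTrivial_skeleton : NormalFormStablyTrivial :=
  NormalFormStablyTrivial_of stub_nielsenLift stub_twistShadowsStandard stub_shadowTwistGate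

end Summit.SmoothPoincare4.SmoothPoincare4.Cruxes.NormalFormStablyTrivial.ShadowSplit

end
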